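import Summits.Ventures.Crystal3D.Theorems.StickyWulffConstantGenericWallFloorBarlowWindowComplete
import Summits.Ventures.Crystal3D.Theorems.StickyWulffConstantGenericWallFloorBarlowWindowExit
import Summits.Ventures.Crystal3D.Theorems.StickyWulffConstantGenericWallFloorBarlowCanonValid
import Summits.Ventures.Crystal3D.Theorems.StickyWulffConstantGenericWallFloorBarlowChainReach
import Summits.Ventures.Crystal3D.Theorems.StickyWulffConstantGenericWallFloorBarlowBottomFamily
import HarnessLib

/-!
# F4, the other plate: the TOP walker family (vertical `−e₃`) of a Barlow|Barlow wall cell delivers every input of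
# `walkerFamilies_card_le_payers` (crux `GenericWallFloor`, stmt-Ventures-19480, line `WallLedgerG`; lane T's F4, cf-p1 §86(58) BA)

HONEST FRAMING. Venture `Summits/Ventures/Crystal3D` (cell `crystal3d-full`), helper `--supports` the crux `GenericWallFloor`
(stmt-Ventures-19480) of `route-Ventures-StickyWulffConstant`, registered line `WallLedgerG`, open stub `stub_twoSlabAdhesion`.
Rung credit only; F-C1 not moved; NOT the stub, not yet F4.

Mirror image of `bottomFamily_spec` (`…BarlowBottomFamily`): the walkers of the TOP plate `P₂ = stacking L₂ s₂ σ₂ ∩ [h+R₀, h+2R₀] × {lat ≤ ρ}`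
run DOWN (vertical `z = −e₃`; the plate presented with its layer index increasing downward — lane T's `axisSign` bookkeeping, word
reversal `isHaggSeq_reverse` / `basalMirror_barlowPos_eq_reverse` of p639985); heights are measured by `⟪·, −e₃⟫`, so the top plate's
window is `[−(h+2R₀), −(h+R₀)]`, the start band `[H, H+1]` with `−(h+2R₀)+2 ≤ H ≤ −(h+R₀)−3`, the exit level `Ztop = −(h+R₀)−2`.

* `barlowWindow_complete_gen` — the clamped plate in an arbitrary height window `[lo, hi]` is complete around its deep sites;
* `walkEnd_not_low_barlow` — the end of a top-family walker lies strictly ABOVE `−R₀−1` (cone drift along `−e₃`, reach set off the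
  BOTTOM stacking, `stacking_sealing_below`), has `≤ 11` contacts and lateral radius `≤ ρ−1`;
* **`topFamily_spec`** — validity, `StackWF`, bottom entry `⟨L₂, v₀, 0⟩`, certificate, fuel, end ∈ `PAY`, end ∈ grain 2's reach
  set, and injectivity of `walkRun X (−e₃) N` on the family.
WHAT THIS IS NOT: F4 still needs `walkerFamilies_card_le_payers` with `hdisj` (reach sets disjoint), the rim lines and the matching with
lane T's count; F-C1 not moved.
-/

noncomputable section

namespace Summit.Ventures.Crystal3D.Theorems

open Finset
open Literature.MathematicalPhysics.StatisticalMechanics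
open Summit.Ventures.Crystal3D.Cruxes.TextureLiminf.TexShadow (stacking)
open scoped InnerProductSpace

variable {X : Finset (EuclideanSpace ℝ (Fin 3))}

/-- **A clamped plate is complete around its deep sites (arbitrary height window).**  `P = stacking L s σ ∩ [lo, hi] × {lat ≤ ρ} ⊆ X`,
`ρ ≥ 1`: every stacking site within distance `1` of a site whose moved image has height in `[lo+1, hi−1]` and lateral size
`≤ (ρ−1)²` is, after the motion, a ball of `X`. -/
theorem barlowWindow_complete_gen {σ : ℤ → ℤ} (L : EuclideanSpace ℝ (Fin 3) ≃ₗᵢ[ℝ] EuclideanSpace ℝ (Fin 3))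
    (s : EuclideanSpace ℝ (Fin 3)) (lo hi ρ : ℝ) (hρ : 1 ≤ ρ) (P : Finset (EuclideanSpace ℝ (Fin 3))) (hPX : P ⊆ X)
    (hP : ∀ p, p ∈ P ↔ (p ∈ stacking L s σ ∧ lo ≤ p 2 ∧ p 2 ≤ hi ∧ p 0 ^ 2 + p 1 ^ 2 ≤ ρ ^ 2))
    (m i j : ℤ)
    (hlo : lo + 1 ≤ (L (barlowPos 1 (Real.sqrt (2 / 3)) σ m i j) + s) 2)
    (hhi : (L (barlowPos 1 (Real.sqrt (2 / 3)) σ m i j) + s) 2 ≤ hi - 1)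
    (hlat : (L (barlowPos 1 (Real.sqrt (2 / 3)) σ m i j) + s) 0 ^ 2 + (L (barlowPos 1 (Real.sqrt (2 / 3)) σ m i j) + s) 1 ^ 2 ≤ (ρ - 1) ^ 2) :
    ∀ q ∈ barlowStacking 1 (Real.sqrt (2 / 3)) σ, dist q (barlowPos 1 (Real.sqrt (2 / 3)) σ m i j) ≤ 1 → L q + s ∈ X := by
  intro q hq hd
  set x := L (barlowPos 1 (Real.sqrt (2 / 3)) σ m i j) + s with hx
  set y := L q + s with hy
  have hdist : dist y x ≤ 1 := by
    rw [hy, hx, dist_eq_norm, show L q + s - (L (barlowPos 1 (Real.sqrt (2 / 3)) σ m i j) + s) =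
      L q - L (barlowPos 1 (Real.sqrt (2 / 3)) σ m i j) by abel, ← map_sub, LinearIsometryEquiv.norm_map, ← dist_eq_norm]
    exact hd
  have h2 : (y 2 - x 2) ^ 2 ≤ dist y x ^ 2 := by
    rw [dist_sq_eq_three]; nlinarith [sq_nonneg (y 0 - x 0), sq_nonneg (y 1 - x 1)]
  obtain ⟨h2a, h2b⟩ := abs_le.1 ((abs_le_of_sq_le_sq h2 dist_nonneg).trans hdist)
  have hlat' : y 0 ^ 2 + y 1 ^ 2 ≤ ρ ^ 2 := by
    have := lateral_sq_le_of_dist_le_one (y := y) (q := x) (r := ρ - 1) (by linarith) hlat hdist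
    simpa using this
  exact hPX ((hP y).2 ⟨⟨q, hq, rfl⟩, by linarith, by linarith, hlat'⟩)

/-- **The end of a top-family walker is not low** (and is laterally inside).  Vertical `−e₃`; cell `X ⊆ [−2R₀, h+2R₀] × {lat ≤ ρ}`,
bottom plate `P₁ = stacking L₁ s₀ σ₁ ∩ [−2R₀, −R₀] × {lat ≤ ρ} ⊆ X` (`σ₁` Hägg); walker: a valid `(−e₃)`-state `s` over the bottom entry `b`,
frames of sound stacks over `b` in `M₂`, `s.1 ∈ reachSet L₂ t₂ M₂` missing the bottom stacking (`hoff`), start at lateral radius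
`≤ ρ − 1 − (8/3)(h + 4R₀)`, fuel `N`.  Then the end is in `X`, has `≤ 11` contacts, lateral size `≤ (ρ−1)²` and height `> −R₀ − 1`. -/
theorem walkEnd_not_low_barlow (hX : ∀ p ∈ X, ∀ q ∈ X, p ≠ q → 1 ≤ dist p q)
    {sE : EuclideanSpace ℝ (Fin 3)} (hsE : sE ∈ fccSlots) (hcert : ExactOnly 0 (fccSlots.filter fun w => 0 < ⟪w, sE⟫_ℝ))
    {σ₁ : ℤ → ℤ} (hσ₁ : IsHaggSeq σ₁) (L₁ L₂ : EuclideanSpace ℝ (Fin 3) ≃ₗᵢ[ℝ] EuclideanSpace ℝ (Fin 3))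
    (s₀ t₂ : EuclideanSpace ℝ (Fin 3)) (R₀ h ρ : ℝ) (hρ : 1 ≤ ρ)
    (P₁ : Finset (EuclideanSpace ℝ (Fin 3))) (hP₁X : P₁ ⊆ X)
    (hcell : ∀ p ∈ X, -(2 * R₀) ≤ p 2 ∧ p 2 ≤ h + 2 * R₀ ∧ p 0 ^ 2 + p 1 ^ 2 ≤ ρ ^ 2)
    (hP₁ : ∀ p, p ∈ P₁ ↔ (p ∈ stacking L₁ s₀ σ₁ ∧ -(2 * R₀) ≤ p 2 ∧ p 2 ≤ -R₀ ∧ p 0 ^ 2 + p 1 ^ 2 ≤ ρ ^ 2))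
    (M₂ : Set (EuclideanSpace ℝ (Fin 3) ≃ₗᵢ[ℝ] EuclideanSpace ℝ (Fin 3))) {b : WalkEntry}
    (hM₂ : ∀ stk : List WalkEntry, StackSound (-EuclideanSpace.single (2 : Fin 3) (1 : ℝ)) stk →
      StackWF (-EuclideanSpace.single (2 : Fin 3) (1 : ℝ)) stk → stk.getLast? = some b → ∀ e ∈ stk, e.frame ∈ M₂)
    (hoff : ∀ y ∈ reachSet L₂ t₂ M₂, y ∉ stacking L₁ s₀ σ₁)
    {s : EuclideanSpace ℝ (Fin 3) × List WalkEntry}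
    (hI : WalkInv X (-EuclideanSpace.single (2 : Fin 3) (1 : ℝ)) s)
    (hW : StackWF (-EuclideanSpace.single (2 : Fin 3) (1 : ℝ)) s.2) (hlast : s.2.getLast? = some b)
    (hreach : s.1 ∈ reachSet L₂ t₂ M₂)
    (hlat : Real.sqrt (s.1 0 ^ 2 + s.1 1 ^ 2) + 8 / 3 * (h + 4 * R₀) ≤ ρ - 1)
    {N : ℕ} (hN : 8 * (2 * R₀ - ⟪s.1, -EuclideanSpace.single (2 : Fin 3) (1 : ℝ)⟫_ℝ) < 3 * N) :
    (walkRun X (-EuclideanSpace.single (2 : Fin 3) (1 : ℝ)) N s).1 ∈ X ∧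
      (X.filter fun q => dist (walkRun X (-EuclideanSpace.single (2 : Fin 3) (1 : ℝ)) N s).1 q = 1).card ≤ 11 ∧
      (walkRun X (-EuclideanSpace.single (2 : Fin 3) (1 : ℝ)) N s).1 0 ^ 2 +
          (walkRun X (-EuclideanSpace.single (2 : Fin 3) (1 : ℝ)) N s).1 1 ^ 2 ≤ (ρ - 1) ^ 2 ∧
      -R₀ - 1 < (walkRun X (-EuclideanSpace.single (2 : Fin 3) (1 : ℝ)) N s).1 2 := by
  set zt : EuclideanSpace ℝ (Fin 3) := -EuclideanSpace.single (2 : Fin 3) (1 : ℝ) with hzt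
  have hztn : ‖zt‖ = 1 := by rw [hzt, norm_neg, PiLp.norm_single, norm_one]
  have hzti : ∀ d : EuclideanSpace ℝ (Fin 3), ⟪d, zt⟫_ℝ = -d 2 := fun d => by
    rw [hzt, inner_neg_right, EuclideanSpace.inner_single_right]; simp
  have hH : ∀ p ∈ X, ⟪p, zt⟫_ℝ ≤ 2 * R₀ := fun p hp => by rw [hzti]; linarith [(hcell p hp).1]
  obtain ⟨hyX, hydeg, hrise, hcone, -, -⟩ := stackWalk_end hX hsE hcert hztn hH hI hN
  set y := (walkRun X zt N s).1 with hy
  have hs1X : s.1 ∈ X := hI.1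
  have hrise' : ⟪y - s.1, zt⟫_ℝ ≤ h + 4 * R₀ := by
    rw [inner_sub_left, hzti, hzti]
    have h1 := (hcell y hyX).1; have h2 := (hcell s.1 hs1X).2.1
    linarith
  have hdrift : ‖y - s.1‖ ≤ 8 / 3 * (h + 4 * R₀) := hcone.trans (by nlinarith)
  have hlat_y : Real.sqrt (y 0 ^ 2 + y 1 ^ 2) ≤ ρ - 1 := by
    have h1 := sqrt_lateral_add_le s.1 (y - s.1)
    rw [add_sub_cancel] at h1
    linarith
  have hlat_y2 : y 0 ^ 2 + y 1 ^ 2 ≤ (ρ - 1) ^ 2 := by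
    have h0 : 0 ≤ y 0 ^ 2 + y 1 ^ 2 := by positivity
    have h7 := pow_le_pow_left₀ (Real.sqrt_nonneg (y 0 ^ 2 + y 1 ^ 2)) hlat_y 2
    rwa [Real.sq_sqrt h0] at h7
  have hyreach : y ∈ reachSet L₂ t₂ M₂ := walkRun_fst_mem_reachSet hX hsE hcert hztn hM₂ N s hI hW hlast hreach
  have hyP₁ : y ∉ P₁ := fun hyP => hoff y hyreach ((hP₁ y).1 hyP).1
  refine ⟨hyX, hydeg, hlat_y2, ?_⟩
  by_contra hlow
  push Not at hlow
  exact stacking_sealing_below hσ₁ L₁ s₀ (-(2 * R₀)) (-R₀) ρ hρ X P₁ hX hP₁X hP₁ y hyX hyP₁ (hcell y hyX).1 (by linarith) hlat_y2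

section Cell

variable (σ₂ : ℤ → ℤ) (L₂ : EuclideanSpace ℝ (Fin 3) ≃ₗᵢ[ℝ] EuclideanSpace ℝ (Fin 3)) (s₂ v₀ : EuclideanSpace ℝ (Fin 3))
  (canon : ℤ → EuclideanSpace ℝ (Fin 3) → EuclideanSpace ℝ (Fin 3) × List WalkEntry) (ms : ℤ → EuclideanSpace ℝ (Fin 3))

open scoped Classical in
/-- **The top family delivers every input of the two-family count** (vertical `−e₃`).  See the module docstring; heights in the
hypotheses `hlow`, `hpred`, `hδ`, `hsteep` are `⟪·, −e₃⟫`-heights, `H ∈ [−(h+2R₀)+2, −(h+R₀)−3]`. -/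
theorem topFamily_spec (hσ₂ : IsHaggSeq σ₂) (hX : ∀ p ∈ X, ∀ q ∈ X, p ≠ q → 1 ≤ dist p q)
    {sE : EuclideanSpace ℝ (Fin 3)} (hsE : sE ∈ fccSlots) (hcert : ExactOnly 0 (fccSlots.filter fun w => 0 < ⟪w, sE⟫_ℝ))
    -- the cell
    {σ₁ : ℤ → ℤ} (hσ₁ : IsHaggSeq σ₁) (L₁ : EuclideanSpace ℝ (Fin 3) ≃ₗᵢ[ℝ] EuclideanSpace ℝ (Fin 3)) (s₀ : EuclideanSpace ℝ (Fin 3))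
    (R₀ h ρ : ℝ) (hR₀ : 6 ≤ R₀) (hh : 0 ≤ h) (hρ : 1 ≤ ρ) (P₁ P₂ : Finset (EuclideanSpace ℝ (Fin 3))) (hP₁X : P₁ ⊆ X) (hP₂X : P₂ ⊆ X)
    (hcell : ∀ p ∈ X, -(2 * R₀) ≤ p 2 ∧ p 2 ≤ h + 2 * R₀ ∧ p 0 ^ 2 + p 1 ^ 2 ≤ ρ ^ 2)
    (hP₁ : ∀ p, p ∈ P₁ ↔ (p ∈ stacking L₁ s₀ σ₁ ∧ -(2 * R₀) ≤ p 2 ∧ p 2 ≤ -R₀ ∧ p 0 ^ 2 + p 1 ^ 2 ≤ ρ ^ 2))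
    (hP₂ : ∀ p, p ∈ P₂ ↔ (p ∈ stacking L₂ s₂ σ₂ ∧ h + R₀ ≤ p 2 ∧ p 2 ≤ h + 2 * R₀ ∧ p 0 ^ 2 + p 1 ^ 2 ≤ ρ ^ 2))
    -- the walk data (vertical −e₃)
    (hv₀ : v₀ ∈ fccSlots) (hv₀2 : v₀ 2 = Real.sqrt (2 / 3))
    (hsteep : Real.sqrt 2 / 2 ≤ ⟪L₂ v₀, -EuclideanSpace.single (2 : Fin 3) (1 : ℝ)⟫_ℝ)
    (hcanon₁ : ∀ m t, σ₂ (m - 1) = 1 → canon m t = (t, [⟨L₂, v₀, 0⟩]))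
    (hcanon₂ : ∀ m t, σ₂ (m - 1) = -1 → canon m t =
      (t, [⟨twinFrame L₂ (L₂ (EuclideanSpace.single (2 : Fin 3) (1 : ℝ))),
            bestCapper (twinFrame L₂ (L₂ (EuclideanSpace.single (2 : Fin 3) (1 : ℝ)))) (L₂ (EuclideanSpace.single (2 : Fin 3) (1 : ℝ)))
              (-EuclideanSpace.single (2 : Fin 3) (1 : ℝ)),
            L₂ (EuclideanSpace.single (2 : Fin 3) (1 : ℝ))⟩, ⟨L₂, v₀, 0⟩]))
    (hms₁ : ∀ m, σ₂ m = 1 → ms m = v₀)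
    (hms₂ : ∀ m, σ₂ m = -1 → ms m =
      basalMirror (bestCapper (twinFrame L₂ (L₂ (EuclideanSpace.single (2 : Fin 3) (1 : ℝ)))) (L₂ (EuclideanSpace.single (2 : Fin 3) (1 : ℝ)))
        (-EuclideanSpace.single (2 : Fin 3) (1 : ℝ))))
    {δ : ℝ} (hδ0 : 0 < δ) (hδ : ∀ m, δ ≤ ⟪L₂ (ms m), -EuclideanSpace.single (2 : Fin 3) (1 : ℝ)⟫_ℝ)
    -- off-registry
    (hoff : ∀ y ∈ reachSet L₂ (L₂ ((haggLabel σ₂ 0 : ℝ) • barlowOffset 1) + s₂) (chainFrames (-EuclideanSpace.single (2 : Fin 3) (1 : ℝ)) L₂ v₀),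
      y ∉ stacking L₁ s₀ σ₁)
    -- the family (heights along −e₃)
    (H ρin : ℝ) (hHlo : -(h + 2 * R₀) + 2 ≤ H) (hHhi : H ≤ -(h + R₀) - 3)
    (hρin : ρin + 8 / 3 * (h + 4 * R₀) + ((-(h + R₀) - 2 - H) / δ + 2) ≤ ρ - 1)
    {ι : Type*} (T : Finset ι) (mi ai bi : ι → ℤ)
    (hlow : ∀ i ∈ T, H ≤ ⟪L₂ (barlowPos 1 (Real.sqrt (2 / 3)) σ₂ (mi i) (ai i) (bi i)) + s₂, -EuclideanSpace.single (2 : Fin 3) (1 : ℝ)⟫_ℝ)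
    (hpred : ∀ i ∈ T, ⟪L₂ (barlowPos 1 (Real.sqrt (2 / 3)) σ₂ (mi i) (ai i) (bi i) - ms (mi i - 1)) + s₂,
      -EuclideanSpace.single (2 : Fin 3) (1 : ℝ)⟫_ℝ < H)
    (hinjT : ∀ i ∈ T, ∀ j ∈ T,
      barlowPos 1 (Real.sqrt (2 / 3)) σ₂ (mi i) (ai i) (bi i) = barlowPos 1 (Real.sqrt (2 / 3)) σ₂ (mi j) (ai j) (bi j) → i = j)
    (hlat : ∀ i ∈ T, Real.sqrt ((L₂ (barlowPos 1 (Real.sqrt (2 / 3)) σ₂ (mi i) (ai i) (bi i)) + s₂) 0 ^ 2 +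
      (L₂ (barlowPos 1 (Real.sqrt (2 / 3)) σ₂ (mi i) (ai i) (bi i)) + s₂) 1 ^ 2) ≤ ρin)
    -- fuel
    {N : ℕ} (hN1 : ⌈(-(h + R₀) - 2 - H) / δ⌉₊ + 1 ≤ N) (hN2 : 8 * (h + 4 * R₀) < 3 * (N : ℝ)) :
    (∀ i ∈ T,
      WalkInv X (-EuclideanSpace.single (2 : Fin 3) (1 : ℝ)) (canon (mi i) (L₂ (barlowPos 1 (Real.sqrt (2 / 3)) σ₂ (mi i) (ai i) (bi i)) + s₂)) ∧
      StackWF (-EuclideanSpace.single (2 : Fin 3) (1 : ℝ)) (canon (mi i) (L₂ (barlowPos 1 (Real.sqrt (2 / 3)) σ₂ (mi i) (ai i) (bi i)) + s₂)).2 ∧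
      (canon (mi i) (L₂ (barlowPos 1 (Real.sqrt (2 / 3)) σ₂ (mi i) (ai i) (bi i)) + s₂)).2.getLast? = some ⟨L₂, v₀, 0⟩ ∧
      (∃ e rest, (canon (mi i) (L₂ (barlowPos 1 (Real.sqrt (2 / 3)) σ₂ (mi i) (ai i) (bi i)) + s₂)).2 = e :: rest ∧
        WalkCertified12 X (canon (mi i) (L₂ (barlowPos 1 (Real.sqrt (2 / 3)) σ₂ (mi i) (ai i) (bi i)) + s₂)).1 e) ∧
      8 * (2 * R₀ - ⟪(canon (mi i) (L₂ (barlowPos 1 (Real.sqrt (2 / 3)) σ₂ (mi i) (ai i) (bi i)) + s₂)).1,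
        -EuclideanSpace.single (2 : Fin 3) (1 : ℝ)⟫_ℝ) < 3 * N ∧
      (walkRun X (-EuclideanSpace.single (2 : Fin 3) (1 : ℝ)) N
          (canon (mi i) (L₂ (barlowPos 1 (Real.sqrt (2 / 3)) σ₂ (mi i) (ai i) (bi i)) + s₂))).1 ∈
        X.filter (fun y => (X.filter fun q => dist y q = 1).card ≠ 12 ∧ -R₀ - 2 ≤ y 2 ∧ y 2 ≤ h + R₀ + 2) ∧
      (walkRun X (-EuclideanSpace.single (2 : Fin 3) (1 : ℝ)) N
          (canon (mi i) (L₂ (barlowPos 1 (Real.sqrt (2 / 3)) σ₂ (mi i) (ai i) (bi i)) + s₂))).1 ∈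
        reachSet L₂ (L₂ ((haggLabel σ₂ 0 : ℝ) • barlowOffset 1) + s₂) (chainFrames (-EuclideanSpace.single (2 : Fin 3) (1 : ℝ)) L₂ v₀)) ∧
    (∀ i ∈ T, ∀ j ∈ T,
      walkRun X (-EuclideanSpace.single (2 : Fin 3) (1 : ℝ)) N (canon (mi i) (L₂ (barlowPos 1 (Real.sqrt (2 / 3)) σ₂ (mi i) (ai i) (bi i)) + s₂)) =
        walkRun X (-EuclideanSpace.single (2 : Fin 3) (1 : ℝ)) N (canon (mi j) (L₂ (barlowPos 1 (Real.sqrt (2 / 3)) σ₂ (mi j) (ai j) (bi j)) + s₂)) →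
      i = j) := by
  set zt : EuclideanSpace ℝ (Fin 3) := -EuclideanSpace.single (2 : Fin 3) (1 : ℝ) with hzt
  have hztn : ‖zt‖ = 1 := by rw [hzt, norm_neg, PiLp.norm_single, norm_one]
  have hzti : ∀ d : EuclideanSpace ℝ (Fin 3), ⟪d, zt⟫_ℝ = -d 2 := fun d => by
    rw [hzt, inner_neg_right, EuclideanSpace.inner_single_right]; simp
  set bp : ℤ → ℤ → ℤ → EuclideanSpace ℝ (Fin 3) := fun m a b => barlowPos 1 (Real.sqrt (2 / 3)) σ₂ m a b with hbp
  set Ztop : ℝ := -(h + R₀) - 2 with hZtop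
  set D : ℝ := (Ztop - H) / δ + 1 with hD
  have hDdef : D = (-(h + R₀) - 2 - H) / δ + 1 := by rw [hD, hZtop]
  have hD0 : 0 ≤ D := by rw [hDdef]; have : 0 ≤ (-(h + R₀) - 2 - H) / δ := div_nonneg (by linarith) hδ0.le; linarith
  -- the deep region of the top plate and its two properties
  set R : Set (EuclideanSpace ℝ (Fin 3)) := {p | h + R₀ + 1 ≤ (L₂ p + s₂) 2 ∧ (L₂ p + s₂) 2 ≤ h + 2 * R₀ - 1 ∧
    (L₂ p + s₂) 0 ^ 2 + (L₂ p + s₂) 1 ^ 2 ≤ (ρ - 1) ^ 2} with hRdef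
  have hR : ∀ m i j : ℤ, bp m i j ∈ R → ∀ q ∈ barlowStacking 1 (Real.sqrt (2 / 3)) σ₂, dist q (bp m i j) ≤ 1 → L₂ q + s₂ ∈ X :=
    fun m i j hm => barlowWindow_complete_gen L₂ s₂ (h + R₀) (h + 2 * R₀) ρ hρ P₂ hP₂X hP₂ m i j hm.1 (by linarith [hm.2.1]) hm.2.2
  have hRin : ∀ i ∈ T, ∀ m a b : ℤ, H ≤ ⟪L₂ (bp m a b) + s₂, zt⟫_ℝ → ⟪L₂ (bp m a b) + s₂, zt⟫_ℝ ≤ Ztop →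
      ‖bp m a b - bp (mi i) (ai i) (bi i)‖ ≤ (Ztop - H) / δ + 1 → bp m a b ∈ R := by
    intro i hi m a b h1 h2 h3
    rw [hzti] at h1 h2
    refine ⟨by rw [hZtop] at h2; linarith, by linarith, ?_⟩
    have hd : dist (L₂ (bp m a b) + s₂) (L₂ (bp (mi i) (ai i) (bi i)) + s₂) ≤ D := by
      rw [dist_eq_norm, show L₂ (bp m a b) + s₂ - (L₂ (bp (mi i) (ai i) (bi i)) + s₂) = L₂ (bp m a b) - L₂ (bp (mi i) (ai i) (bi i)) by abel,
        ← map_sub, LinearIsometryEquiv.norm_map, hD]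
      exact h3
    have hr := lateral_radius_le_add_dist (L₂ (bp m a b) + s₂) (L₂ (bp (mi i) (ai i) (bi i)) + s₂)
    have hr' : Real.sqrt ((L₂ (bp m a b) + s₂) 0 ^ 2 + (L₂ (bp m a b) + s₂) 1 ^ 2) ≤ ρ - 1 := by
      have := hlat i hi; rw [hDdef] at hd; nlinarith [hρin, hh, hR₀]
    have h0 : 0 ≤ (L₂ (bp m a b) + s₂) 0 ^ 2 + (L₂ (bp m a b) + s₂) 1 ^ 2 := by positivity
    have h7 := pow_le_pow_left₀ (Real.sqrt_nonneg _) hr' 2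
    rwa [Real.sq_sqrt h0] at h7
  -- positions / bottom entries of canonical states; unit steps
  have hpos : ∀ m t, (canon m t).1 = t := by
    intro m t
    rcases hσ₂ (m - 1) with hm | hm
    · rw [hcanon₁ m t hm]
    · rw [hcanon₂ m t hm]
  have hlast : ∀ m t, (canon m t).2.getLast? = some ⟨L₂, v₀, 0⟩ := by
    intro m t
    rcases hσ₂ (m - 1) with hm | hm
    · rw [hcanon₁ m t hm]; rfl
    · rw [hcanon₂ m t hm]; rfl
  have hms : ∀ m, ‖ms m‖ = 1 := by
    intro m
    rcases hσ₂ m with hm | hm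
    · rw [hms₁ m hm, norm_eq_one_of_mem_fccSlots hv₀]
    · rw [hms₂ m hm, LinearIsometryEquiv.norm_map, norm_eq_one_of_mem_fccSlots (bestCapper_nabla_slot L₂ zt).1]
  -- validity of every start
  have hvalid : ∀ i ∈ T, WalkInv X zt (canon (mi i) (L₂ (bp (mi i) (ai i) (bi i)) + s₂)) ∧
      StackWF zt (canon (mi i) (L₂ (bp (mi i) (ai i) (bi i)) + s₂)).2 ∧
      ∃ e rest, (canon (mi i) (L₂ (bp (mi i) (ai i) (bi i)) + s₂)).2 = e :: rest ∧
        WalkCertified12 X (canon (mi i) (L₂ (bp (mi i) (ai i) (bi i)) + s₂)).1 e := by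
    intro i hi
    obtain ⟨a', b', hab⟩ := pred_mem_barlowLayer σ₂ hσ₂ L₂ zt v₀ ms hv₀ hv₀2 hms₁ hms₂ (mi i) (ai i) (bi i)
    have hpredeq : bp (mi i - 1) a' b' + ms (mi i - 1) = bp (mi i) (ai i) (bi i) := by
      show barlowPos 1 (Real.sqrt (2 / 3)) σ₂ (mi i - 1) a' b' + ms (mi i - 1) = barlowPos 1 (Real.sqrt (2 / 3)) σ₂ (mi i) (ai i) (bi i)
      rw [← hab, sub_add_cancel]
    have hph : ⟪L₂ (bp (mi i - 1) a' b') + s₂, zt⟫_ℝ < H := by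
      have := hpred i hi; rw [hab] at this; exact this
    have hpl : H - 1 ≤ ⟪L₂ (bp (mi i - 1) a' b') + s₂, zt⟫_ℝ := by
      have h1 := height_step_le L₂ s₂ zt ms hztn hms (bp (mi i - 1) a' b') (mi i - 1)
      rw [hpredeq] at h1
      have h2 := hlow i hi
      linarith
    have hplat : Real.sqrt ((L₂ (bp (mi i - 1) a' b') + s₂) 0 ^ 2 + (L₂ (bp (mi i - 1) a' b') + s₂) 1 ^ 2) ≤ ρin + 1 := by
      have h1 := lateral_radius_le_add_dist (L₂ (bp (mi i - 1) a' b') + s₂) (L₂ (bp (mi i) (ai i) (bi i)) + s₂)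
      have h2 : dist (L₂ (bp (mi i - 1) a' b') + s₂) (L₂ (bp (mi i) (ai i) (bi i)) + s₂) ≤ 1 := by
        rw [dist_eq_norm, show L₂ (bp (mi i - 1) a' b') + s₂ - (L₂ (bp (mi i) (ai i) (bi i)) + s₂) =
          L₂ (bp (mi i - 1) a' b') - L₂ (bp (mi i) (ai i) (bi i)) by abel, ← map_sub, LinearIsometryEquiv.norm_map,
          ← hpredeq, show bp (mi i - 1) a' b' - (bp (mi i - 1) a' b' + ms (mi i - 1)) = -ms (mi i - 1) by abel, norm_neg, hms]
      have h3 := hlat i hi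
      linarith
    have hXpred : ∀ q ∈ barlowStacking 1 (Real.sqrt (2 / 3)) σ₂, dist q (bp (mi i - 1) a' b') ≤ 1 → L₂ q + s₂ ∈ X := by
      rw [hzti] at hph hpl
      refine hR (mi i - 1) a' b' ⟨?_, ?_, ?_⟩
      · linarith
      · linarith
      · have h0 : 0 ≤ (L₂ (bp (mi i - 1) a' b') + s₂) 0 ^ 2 + (L₂ (bp (mi i - 1) a' b') + s₂) 1 ^ 2 := by positivity
        have hr : Real.sqrt ((L₂ (bp (mi i - 1) a' b') + s₂) 0 ^ 2 + (L₂ (bp (mi i - 1) a' b') + s₂) 1 ^ 2) ≤ ρ - 1 := by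
          nlinarith [hplat, hρin, hD0, hh]
        have h7 := pow_le_pow_left₀ (Real.sqrt_nonneg _) hr 2
        rwa [Real.sq_sqrt h0] at h7
    have key := canon_start_valid (σ := σ₂) (L := L₂) (s₀ := s₂) (z := zt) (v₀ := v₀) (canon := canon) (ms := ms)
      hσ₂ hztn hv₀ hv₀2 hsteep hcanon₁ hcanon₂ hms₁ hms₂ (k := mi i - 1) (i := a') (j := b') hXpred
    have e1 : mi i - 1 + 1 = mi i := by ring
    rw [e1] at key
    have e2 : barlowPos 1 (Real.sqrt (2 / 3)) σ₂ (mi i - 1) a' b' + ms (mi i - 1) = bp (mi i) (ai i) (bi i) := hpredeq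
    rw [e2] at key
    exact key
  -- injectivity
  have hinj := windowFamily_walkRun_injOn (σ := σ₂) (L := L₂) (s₀ := s₂) (z := zt) (v₀ := v₀) (ms := ms) (canon := canon)
    hσ₂ hX hsE hcert hztn hv₀ hv₀2 hcanon₁ hcanon₂ hms₁ hms₂ hδ0 hδ R hR H Ztop (by rw [hZtop]; linarith) T mi ai bi hRin hlow hpred
    hinjT (fun i hi => ⟨(hvalid i hi).1, (hvalid i hi).2.1⟩) N
  refine ⟨fun i hi => ?_, hinj⟩
  obtain ⟨hI, hW, hC⟩ := hvalid i hi
  have hstart2 : -(h + 2 * R₀) ≤ ⟪(canon (mi i) (L₂ (bp (mi i) (ai i) (bi i)) + s₂)).1, zt⟫_ℝ := by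
    rw [hzti]; linarith [(hcell _ hI.1).2.1]
  have hfuel : 8 * (2 * R₀ - ⟪(canon (mi i) (L₂ (bp (mi i) (ai i) (bi i)) + s₂)).1, zt⟫_ℝ) < 3 * N := by linarith
  -- below the window after the fuel (heights along −e₃)
  have hgt := windowStart_end_height_gt (σ := σ₂) (L := L₂) (s₀ := s₂) (z := zt) (v₀ := v₀) (canon := canon) (ms := ms)
    hσ₂ hX hsE hcert hztn hv₀ hv₀2 hcanon₁ hcanon₂ hms₁ hms₂ hδ0 hδ R hR H Ztop (by rw [hZtop]; linarith) (mi i) (ai i) (bi i)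
    (hRin i hi) (hlow i hi) ⟨hI, hW⟩ (N := N) (by rw [hZtop]; exact hN1)
  have hhigh' : (walkRun X zt N (canon (mi i) (L₂ (bp (mi i) (ai i) (bi i)) + s₂))).1 2 ≤ h + R₀ + 2 := by
    rw [hzti, hZtop] at hgt; linarith
  -- reach set of the start, frames, lateral, then «not low»
  have hreach : (canon (mi i) (L₂ (bp (mi i) (ai i) (bi i)) + s₂)).1 ∈
      reachSet L₂ (L₂ ((haggLabel σ₂ 0 : ℝ) • barlowOffset 1) + s₂) (chainFrames zt L₂ v₀) := by
    rw [hpos]; exact barlow_mem_reachSet_chainFrames zt L₂ s₂ hσ₂ hv₀2 (mi i) (ai i) (bi i)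
  have hM₂ : ∀ stk : List WalkEntry, StackSound zt stk → StackWF zt stk → stk.getLast? = some ⟨L₂, v₀, 0⟩ →
      ∀ e ∈ stk, e.frame ∈ chainFrames zt L₂ v₀ := fun stk hS hWF hl => frame_mem_chainFrames_of_stack hS hWF hl
  have hlat' : Real.sqrt ((canon (mi i) (L₂ (bp (mi i) (ai i) (bi i)) + s₂)).1 0 ^ 2 +
      (canon (mi i) (L₂ (bp (mi i) (ai i) (bi i)) + s₂)).1 1 ^ 2) + 8 / 3 * (h + 4 * R₀) ≤ ρ - 1 := by
    rw [hpos]; have := hlat i hi; linarith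
  obtain ⟨hyX, hydeg, -, hnotlow⟩ := walkEnd_not_low_barlow hX hsE hcert hσ₁ L₁ L₂ s₀ (L₂ ((haggLabel σ₂ 0 : ℝ) • barlowOffset 1) + s₂)
    R₀ h ρ hρ P₁ hP₁X hcell hP₁ (chainFrames zt L₂ v₀) hM₂ hoff hI hW (hlast _ _) hreach hlat' hfuel
  have hendreach := walkRun_fst_mem_reachSet hX hsE hcert hztn hM₂ N _ hI hW (hlast _ _) hreach
  refine ⟨hI, hW, hlast _ _, hC, hfuel, ?_, hendreach⟩
  rw [Finset.mem_filter]
  exact ⟨hyX, Nat.ne_of_lt (Nat.lt_of_le_of_lt hydeg (by norm_num)), by linarith, hhigh'⟩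

end Cell

end Summit.Ventures.Crystal3D.Theorems

end
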